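/-
Copyright (c) 2026 the pub-hodgecm-mathlib formalisation cell (harness21).  Prover seat hodgecm-mathlib-K2E1-p13 (g0), Track B ∕ K2-LIT, h413 = `stmt-HodgeConjecture-24833`,
line `K2_E1_TraceFormulaBeta`, campaign «R8₂-sph EXHAUSTION», ROAD T′ step T2 «c on the unitary axis» (dealer K2E1-plan (g6) deal (81) 2026-09-04T10:36:34Z; census 10:38Z):
`‖c̃(½ + it)‖ = 1` for the continued scattering scalar of `U(1,1)_{L∕L⁺}`, HYPOTHESIS-FIRST on the functional equation (T2a), with the reflection symmetry (T2b) PROVED.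
-/
import Summits.HodgeConjecture.HodgeConjecture.Theorems.K2E1MaassSelbergContinuedCMTwo   -- ★ p858755: Schwarz reflection `differentiableOn_conj_comp_conj`; brings ★ `K2E1MaassSelbergPoleControl.conj_ofReal_cpow`
import Mathlib.Analysis.Complex.CauchyIntegral
import HarnessLib

/-!
# R8₂-sph ROAD T′, T2 — `K2E1ScatteringUnitaryAxisCMTwo`: the scattering scalar on the unitary axis `Re z = ½` — `c̃(conj z) = conj c̃(z)` (PROVED from the tube formula) and
# `‖c̃(½+it)‖ = 1` modulo the functional equation `c̃(z)·c̃(1−z) = 1`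

Track B ∕ K2-LIT, crux h413 = `stmt-HodgeConjecture-24833`, route of record `HCCMUnconditional`; cell `hodgecm-mathlib`, squad K2, ENGINE E1.  THEOREMS ONLY (no `def`, no `instance`,
no `notation`, no `sorry`; default heartbeats); lane `--supports stmt-HodgeConjecture-24833 --as helper` (count-neutral).
THE MATHEMATICS ([Langlands1976, §7]; [MoeglinWaldspurger1995, IV.1.10–IV.1.11, IV.3.12]; [Iwaniec2002, §6.3, Thm. 6.6]).  Let `c` be holomorphic on a preconnected, conjugation-symmetric open
`U ⊇ {Re z > 1}` and given on the tube by a REAL kernel, `c(z) = ∫ H(x)^z dμ(x)` with `H > 0` (the spherical intertwining scalar `∫_{N(𝔸)} H(ι(w₀)·v)^z dν` of ★ (R6k)₂ ∕ ★ W5-B).  (T2b) Then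
`z ↦ conj c(conj z)` is holomorphic on `U` (Schwarz reflection ★ `differentiableOn_conj_comp_conj`) and agrees with `c` on the tube (`conj H^z = H^{conj z}`, ★ `conj_ofReal_cpow`, Mathlib
`integral_conj`), hence on `U` by the identity theorem (Mathlib `AnalyticOnNhd.eqOn_of_preconnected_of_eventuallyEq`): **`c(conj z) = conj c(z)` on `U`** (§2).  (T2a → T2) On the unitary axis
`z = ½ + it` one has `1 − z = conj z`, so the functional equation `c(z)c(1−z) = 1` (the LETTER `hFE`, payer of record: the B–L uniqueness road (ii-BL) of the census — `Ẽ(1−z)∕c̃(1−z)` solves the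
`𝔛_z`-system, ★ `hunq_cm_two`) reads `c(z)·conj c(z) = 1`, i.e. **`‖c(½+it)‖ = 1`** (§1 pure algebra, §3 HEAD).  This is the input of the contour shift T4 on the axis (together with T1 ★
p859417 off the axis).
* §1 `norm_eq_one_of_mul_one_sub_eq_one` (pure algebra on the axis: `1 − z = conj z` there).
* §2 `conj_integral_ofReal_cpow` (`conj ∫ H^z = ∫ H^{conj z}`), **`apply_conj_eq_conj_apply_of_tube`** (T2b PROVED: reflection symmetry of any holomorphic `c` given by a positive real kernel on the tube).
* §3 HEAD **`norm_eq_one_on_axis_of_fe`** — `‖c(½+it)‖ = 1` for all `t`, modulo the functional equation on the axis ONLY.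
HONEST LABEL: HC_CM is proved only modulo the 7 printed citations (2 remaining named inputs: hLiu418 = `stmt-HodgeConjecture-24832`, h413 = `stmt-HodgeConjecture-24833`) until rung 0
closes; this file asserts no named fact, closes no socket; count-neutral; §3 is CONDITIONAL on the displayed letter `hFE`.

## References
* [Langlands1976] R. P. Langlands, *On the Functional Equations Satisfied by Eisenstein Series*, LNM 544 (1976), §7.
* [MoeglinWaldspurger1995] C. Mœglin, J.-L. Waldspurger, *Spectral decomposition and Eisenstein series* (1995), IV.1.10–IV.1.11, IV.3.12.
* [Iwaniec2002] H. Iwaniec, *Spectral Methods of Automorphic Forms*, 2nd ed. (2002), §6.3, Thm. 6.6 (functional equation and unitarity of the scattering matrix).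
* [BernsteinLapid2019] J. Bernstein, E. Lapid, *On the meromorphic continuation of Eisenstein series*, J. AMS 37 (2024), §5 (functional equations from uniqueness).
-/

set_option autoImplicit false
set_option linter.dupNamespace false  -- the mandated namespace repeats the summit's segment (`HodgeConjecture.HodgeConjecture`)

noncomputable section

open MeasureTheory Set Filter Topology
open scoped ComplexConjugate
open Summit.HodgeConjecture.HodgeConjecture.Cruxes.H413.K2E1MaassSelbergContinuedCMTwo (differentiableOn_conj_comp_conj)
open Summit.HodgeConjecture.HodgeConjecture.Cruxes.H413.K2E1MaassSelbergPoleControl (conj_ofReal_cpow)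

namespace Summit.HodgeConjecture.HodgeConjecture.Cruxes.H413.K2E1ScatteringUnitaryAxisCMTwo

/-! ## §1 Pure algebra on the unitary axis -/

/-- **`‖c(z)‖ = 1` ON THE AXIS from the functional equation and the reflection symmetry**: `c(z)·c(1−z) = 1`, `c(conj z) = conj c(z)` and `Re z = ½` give `c(z)·conj c(z) = 1`, i.e.
`‖c(z)‖² = 1`. [cite: Iwaniec2002, Thm. 6.6] [cite: MoeglinWaldspurger1995, IV.3.12] -/
theorem norm_eq_one_of_mul_one_sub_eq_one {c : ℂ → ℂ} {z : ℂ} (hFE : c z * c (1 - z) = 1) (hsym : c (conj z) = conj (c z)) (hz : z.re = 1 / 2) :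
    ‖c z‖ = 1 := by
  -- on the axis `1 − z = conj z` (cf. ★ `Literature.NumberTheory.LFunctions.Zhang2022.Lemma45.one_sub_eq_conj_of_re_eq_half`, not imported: that module pulls all of Mathlib)
  have h1 : 1 - z = conj z := Complex.ext (by simp only [Complex.sub_re, Complex.one_re, Complex.conj_re, hz]; norm_num)
    (by simp only [Complex.sub_im, Complex.one_im, Complex.conj_im, zero_sub])
  rw [h1, hsym, Complex.mul_conj] at hFE
  have h2 : ‖c z‖ ^ 2 = 1 := by
    rw [← Complex.normSq_eq_norm_sq]
    exact_mod_cast hFE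
  rw [← Real.sqrt_sq (norm_nonneg (c z)), h2, Real.sqrt_one]

/-! ## §2 (T2b) The reflection symmetry `c(conj z) = conj c(z)` from the real kernel on the tube -/

/-- **`conj ∫ H(x)^z dμ = ∫ H(x)^{conj z} dμ`** for a positive real kernel `H` (Mathlib `integral_conj`, ★ `conj_ofReal_cpow`). [folklore] -/
theorem conj_integral_ofReal_cpow {X : Type*} [MeasurableSpace X] (μ : Measure X) {H : X → ℝ} (hH : ∀ x, 0 < H x) (z : ℂ) :
    conj (∫ x, ((H x : ℝ) : ℂ) ^ z ∂μ) = ∫ x, ((H x : ℝ) : ℂ) ^ (conj z) ∂μ := by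
  rw [← integral_conj]
  exact integral_congr_ae (Eventually.of_forall fun x => conj_ofReal_cpow (hH x) z)

/-- **(T2b) THE REFLECTION SYMMETRY OF THE SCATTERING SCALAR.**  Let `U ⊆ ℂ` be open, preconnected, conjugation-symmetric and containing the tube `{Re z > 1}`; `c` holomorphic on `U`
and given on the tube by a positive real kernel, `c(z) = ∫ H(x)^z dμ`.  THEN **`c(conj z) = conj c(z)` for every `z ∈ U`**: `z ↦ conj c(conj z)` is holomorphic on `U` (Schwarz reflection ★
`differentiableOn_conj_comp_conj`), equals `c` on the open tube (`conj H^{conj z} = H^z`), hence on `U` by the identity theorem. [cite: MoeglinWaldspurger1995, IV.1.10] [cite: Langlands1976, §7] -/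
theorem apply_conj_eq_conj_apply_of_tube {U : Set ℂ} (hU : IsOpen U) (hUc : IsPreconnected U) (hUsym : ∀ z ∈ U, conj z ∈ U)
    (hUtube : {z : ℂ | 1 < z.re} ⊆ U) {c : ℂ → ℂ} (hc : DifferentiableOn ℂ c U)
    {X : Type*} [MeasurableSpace X] (μ : Measure X) {H : X → ℝ} (hH : ∀ x, 0 < H x)
    (hceq : ∀ z : ℂ, 1 < z.re → c z = ∫ x, ((H x : ℝ) : ℂ) ^ z ∂μ) :
    ∀ z ∈ U, c (conj z) = conj (c z) := by
  -- the reflected function `g z := conj (c (conj z))`, holomorphic on `conj⁻¹U = U`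
  have hpre : {w : ℂ | conj w ∈ U} = U := by
    ext w
    refine ⟨fun h => ?_, fun h => hUsym w h⟩
    have := hUsym _ h
    rwa [Complex.conj_conj] at this
  have hg : DifferentiableOn ℂ (fun z : ℂ => conj (c (conj z))) U := by
    have h := differentiableOn_conj_comp_conj hU hc
    rwa [hpre] at h
  -- `g = c` on the open tube
  have h2 : (2 : ℂ) ∈ U := hUtube (by simp)
  have hev : (fun z : ℂ => conj (c (conj z))) =ᶠ[𝓝 (2 : ℂ)] c := by
    have hopen : IsOpen {z : ℂ | 1 < z.re} := isOpen_lt continuous_const Complex.continuous_re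
    filter_upwards [hopen.mem_nhds (show (2 : ℂ) ∈ {z : ℂ | 1 < z.re} by simp)] with z hz
    have hz' : 1 < (conj z).re := by rwa [Complex.conj_re]
    rw [hceq (conj z) hz', conj_integral_ofReal_cpow μ hH, Complex.conj_conj, ← hceq z hz]
  -- identity theorem on the preconnected `U`
  have heq := (hg.analyticOnNhd hU).eqOn_of_preconnected_of_eventuallyEq (hc.analyticOnNhd hU) hUc h2 hev
  intro z hz
  have h := heq (hUsym z hz)
  simp only [Complex.conj_conj] at h
  -- `h : conj (c z) = c (conj z)`
  exact h.symm

/-! ## §3 HEAD: `‖c(½ + it)‖ = 1` modulo the functional equation on the axis -/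

/-- **HEAD — T2: THE SCATTERING SCALAR IS UNITARY ON THE UNITARY AXIS, MODULO THE FUNCTIONAL EQUATION.**  In the setting of §2 (`U` open, preconnected, conjugation-symmetric,
`⊇ {Re > 1}`; `c` holomorphic on `U` with the positive real kernel formula on the tube) suppose the axis `{½ + it}` lies in `U` and the functional equation **(hFE)**
`c(½+it)·c(1 − (½+it)) = 1` holds on it (LETTER; payer of record: the B–L uniqueness road, `Ẽ(1−z)∕c̃(1−z)` solves the `𝔛_z`-system ⇒ ★ `hunq_cm_two`).  THEN **`‖c(½ + it)‖ = 1` for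
every real `t`** (§2 ⇒ `c(conj z) = conj c(z)`; §1).  With T1 ★ p859417 this is the growth∕axis input of the contour shift T4. [cite: Iwaniec2002, §6.3, Thm. 6.6] [cite: Langlands1976, §7]
[cite: MoeglinWaldspurger1995, IV.3.12] -/
theorem norm_eq_one_on_axis_of_fe {U : Set ℂ} (hU : IsOpen U) (hUc : IsPreconnected U) (hUsym : ∀ z ∈ U, conj z ∈ U)
    (hUtube : {z : ℂ | 1 < z.re} ⊆ U) {c : ℂ → ℂ} (hc : DifferentiableOn ℂ c U)
    {X : Type*} [MeasurableSpace X] (μ : Measure X) {H : X → ℝ} (hH : ∀ x, 0 < H x)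
    (hceq : ∀ z : ℂ, 1 < z.re → c z = ∫ x, ((H x : ℝ) : ℂ) ^ z ∂μ)
    (haxis : ∀ t : ℝ, (1 / 2 : ℂ) + (t : ℂ) * Complex.I ∈ U)
    (hFE : ∀ t : ℝ, c ((1 / 2 : ℂ) + (t : ℂ) * Complex.I) * c (1 - ((1 / 2 : ℂ) + (t : ℂ) * Complex.I)) = 1) :
    ∀ t : ℝ, ‖c ((1 / 2 : ℂ) + (t : ℂ) * Complex.I)‖ = 1 := fun t =>
  norm_eq_one_of_mul_one_sub_eq_one (hFE t) (apply_conj_eq_conj_apply_of_tube hU hUc hUsym hUtube hc μ hH hceq _ (haxis t))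
    (by simp)

end Summit.HodgeConjecture.HodgeConjecture.Cruxes.H413.K2E1ScatteringUnitaryAxisCMTwo

end
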